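import Mathlib
import Summits.Langlands.Langlands.Theorems.ExteriorSquareAscentSelfTwistedIrreducibleDefs
import Summits.Langlands.Langlands.Theorems.ExteriorSquareAscentSelfTwistedIrreducibleCliffordDichotomy
import Literature.NumberTheory.Automorphic.QuadraticCharacterTwist
import Literature.NumberTheory.GaloisRepresentations.RestrictFieldSemisimple
import Literature.NumberTheory.GaloisRepresentations.FramedGaloisRepInduce
import Literature.NumberTheory.GaloisRepresentations.FrobeniusPlaces
import Literature.NumberTheory.GaloisRepresentations.FrobeniusDensityTheorem
import Literature.NumberTheory.GaloisRepresentations.LAdicRepFrobenius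
import Literature.NumberTheory.Automorphic.ChebotarevArtinRepHolds
import Literature.NumberTheory.GaloisRepresentations.FramedRepTwist
import Literature.NumberTheory.Automorphic.BockleHuiIrreducibleGL3Proofs
import Literature.NumberTheory.GaloisRepresentations.TwistedSumAssembly
import Literature.FieldTheory.Galois.SolvableCompositum
import Summits.Langlands.Langlands.Theorems.IrreducibilityBySelfDualityEssSelfDualIrreducibleCMFrobenius
import Summits.Langlands.Langlands.Theorems.IrreducibilityBySelfDualityIrreducibleGL3CMCyclotomicUntwist
import HarnessLib

/-!
# Crux `SelfTwistedIrreducible` (stmt-Langlands-18055), line `Sketch`: stub `stub_cliffordDichotomy`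

Route `ExteriorSquareAscent` (file 3 of 3 for this stub; algebra in `…CliffordLemmas.lean`,
`…CliffordDichotomy.lean`).  THE STUB (registered signature, verbatim): for `π` cuspidal on `GL₄/K`
Satake-self-twisted by the quadratic sign of `L/K` a.e. (`IsQuadSelfTwisted π L`) and a semisimple
`ρ : Γ_K → GL₄(ℚ̄_ℓ)` compatible with `π` a.e. (`IsCompatibleWith π ι ρ`) which is NOT irreducible,
the restriction `ρ|_{Γ_L}` is a sum of four characters (`IsSumOfFourCharacters`) or doubled
(`IsDoubled`: `charpoly ρ|_{Γ_L}(σ) = (charpoly W(σ))²`) at the level of characteristic polynomials.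

Proof: `ε` = the sign character of the index-two open subgroup `res(Γ_L) ≤ Γ_K` (`signCharOfIndexTwo`,
continuous); `ρ ⊗ ε` (`FramedRep.twist`) and `ρ` are semisimple with the same Frobenius characteristic
polynomials at almost every place — at a split place the Frobenius lies in `res(Γ_L)`
(`exists_place_inert_of_not_mem_range` contrapositively), at an inert one `ε = -1` and
`charpoly(-ρ(Frob)) = charpoly(ρ(Frob))` because `-t_{π,v} = t_{π,v}` — hence isomorphic by Chebotarev +
Brauer–Nesbitt (`nonempty_equiv_of_hasFrobCharpolyAt_eventually`, `chebotarev_artinRep_holds`); the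
algebraic dichotomy `exists_eigenbasis_or_doubled_of_twist_equiv` then gives an `H`-eigenbasis (four
continuous characters by `FramedRep.exists_rankOne_of_stableLine`, diagonal matrices) or `G`-stable
planes `U ⊕ U'` with an `H`-isomorphism `U ≃ U'` (frame `U` continuously, `ContinuousRep.frame`;
`charpoly = charpoly|_U · charpoly|_{U'}` and the two factors agree by conjugation).
-/

set_option linter.dupNamespace false -- `Summit.Langlands.Langlands` is the mandated namespace

noncomputable section

namespace Summit.Langlands.Langlands.Cruxes.SelfTwistedIrreducible.DetPinning


open scoped NumberField Polynomial Classical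
open Filter Polynomial NumberField IsDedekindDomain Field Matrix
open Literature.NumberTheory.GaloisRepresentations Literature.NumberTheory.Automorphic

/-- `-1 ≠ 1` in the units of a field of characteristic zero. -/
theorem neg_one_ne_one_units {A : Type*} [Field A] [CharZero A] : (-1 : Aˣ) ≠ 1 := by
  intro h
  have h2 : ((-1 : Aˣ) : A) = ((1 : Aˣ) : A) := by rw [h]
  rw [Units.val_neg, Units.val_one] at h2
  exact two_ne_zero (α := A) (by linear_combination -h2)

/-- **The self-twist gives `ρ ⊗ ε ≅ ρ`.** For `π` Satake-self-twisted by the quadratic sign of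
`L/K` a.e. and `ρ` semisimple and compatible with `π` a.e., and `ε` the quadratic character of
`Γ_K` cutting out `L` (`1` on `res(Γ_L)`, `-1` off it), the twist `ρ ⊗ ε` and `ρ` have the same
Frobenius characteristic polynomials at almost every place (at a split `v` the Frobenius lies in
`res(Γ_L)`; at an inert `v` it does not, and `charpoly(-ρ(Frob_v)) = charpoly(ρ(Frob_v))` because
`-t_{π,v} = t_{π,v}`), hence are isomorphic by Chebotarev + Brauer–Nesbitt
(`nonempty_equiv_of_hasFrobCharpolyAt_eventually`). [folklore] -/
theorem nonempty_equiv_twist_of_isQuadSelfTwisted (K : Type) [Field K] [NumberField K]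
    {hcpt : isCompact_glFiniteIntegralLevel 4 K} (π : CuspidalAutomorphicRepData 4 K hcpt)
    (L : Type) [Field L] [NumberField L] [Algebra K L] (hq : IsQuadSelfTwisted π L)
    {ℓ : ℕ} [Fact ℓ.Prime] (ι : PadicAlgCl ℓ ≃+* ℂ) (ρ : FramedGaloisRep K (PadicAlgCl ℓ) 4)
    (hss : ρ.toGaloisRep.IsSemisimple) (hcomp : IsCompatibleWith π ι ρ)
    (ε : absoluteGaloisGroup K →ₜ* (PadicAlgCl ℓ)ˣ)
    (hε1 : ∀ g ∈ (absGaloisRestrict K L).range, ε g = 1)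
    (hε2 : ∀ g ∉ (absGaloisRestrict K L).range, ε g = -1) :
    Nonempty (ContinuousRep.Equiv (FramedGaloisRep.toGaloisRep (FramedRep.twist ρ ε)) ρ.toGaloisRep) := by
  obtain ⟨h2, htw⟩ := hq
  set ρ' : FramedGaloisRep K (PadicAlgCl ℓ) 4 := FramedRep.twist ρ ε with hρ'def
  haveI : FiniteDimensional K L := Module.finite_of_finrank_pos (by rw [h2]; exact two_pos)
  haveI : Algebra.IsSeparable K L := Algebra.IsSeparable.of_integral K L
  haveI : IsGalois K L := Literature.FieldTheory.Galois.isGalois_of_finrank_eq_two (F := K) h2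
  have hprime : (Module.finrank K L).Prime := by rw [h2]; exact Nat.prime_two
  set H : Subgroup (absoluteGaloisGroup K) := (absGaloisRestrict K L).range with hHdef
  have hHn : H.Normal := normal_range_absGaloisRestrict K L
  have hHi : H.index = Module.finrank K L :=
    (isOpen_range_absGaloisRestrict_and_index_eq_two K L h2).2.trans h2.symm
  -- semisimplicity of the twist
  have hss' : ρ'.toGaloisRep.IsSemisimple := by
    change (FramedRep.toRepresentation (FramedRep.twist ρ ε)).IsSemisimpleRepresentation
    rw [Summit.Langlands.Langlands.Theorems.EssSelfDualIrreducibleCM.toRepresentation_twist]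
    exact (Literature.RepresentationTheory.Semisimple.Representation.isSemisimpleRepresentation_twist_iff
      _ _).mpr hss
  -- the same Frobenius characteristic polynomials almost everywhere
  have hunrL : ∀ᶠ v : HeightOneSpectrum (𝓞 K) in cofinite, Algebra.IsUnramifiedIn (𝓞 L) v.asIdeal := by
    have := (finite_setOf_not_isUnramifiedIn K L).compl_mem_cofinite
    filter_upwards [this] with v hv
    simpa using hv
  have h : ∀ᶠ v : HeightOneSpectrum (𝓞 K) in cofinite,
      ρ'.IsUnramifiedAt v ∧ ρ.IsUnramifiedAt v ∧
        ∃ P : Polynomial (PadicAlgCl ℓ), ρ'.HasFrobCharpolyAt v P ∧ ρ.HasFrobCharpolyAt v P := by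
    filter_upwards [hcomp, htw, eventually_forall_inertia_le_range_absGaloisRestrict (K := K) (F := L),
      hunrL] with v hv hst hI hunr
    obtain ⟨α, hα, hur, hP⟩ := hv
    refine ⟨fun 𝔓 h𝔓 σ hσ => ?_, hur, _, fun 𝔓 h𝔓 Φ hΦ => ?_, hP⟩
    · -- unramified
      have h1 : ρ σ = 1 := hur 𝔓 h𝔓 σ hσ
      show FramedRep.twist ρ ε σ = 1
      rw [FramedRep.twist_apply, hε1 σ (hI 𝔓 h𝔓 hσ), map_one, h1, one_mul]
    · -- Frobenius characteristic polynomial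
      have hch : FramedRep.charpoly ρ Φ = arithFrobPolyOfSatake ι v.residueCard 4 α := hP 𝔓 h𝔓 Φ hΦ
      show FramedRep.charpoly (FramedRep.twist ρ ε) Φ = _
      unfold FramedRep.charpoly at hch ⊢
      rw [FramedRep.coe_twist_apply]
      by_cases hΦH : Φ ∈ H
      · rw [hε1 Φ hΦH, Units.val_one, one_smul, hch]
      · -- `v` is inert: no place of residue degree one above it
        have hnosplit : ¬ ∃ w : HeightOneSpectrum (𝓞 L),
            w.asIdeal.under (𝓞 K) = v.asIdeal ∧ w.asIdeal.inertiaDeg (𝓞 K) = 1 := by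
          obtain ⟨w, -, -, -, huniq, hfw, -⟩ :=
            exists_place_inert_of_not_mem_range hprime hHn hHi hunr h𝔓 (hI 𝔓 h𝔓) hΦ hΦH
          rintro ⟨w', hw'v, hf1⟩
          have hw' : w'.under (𝓞 K) = v := HeightOneSpectrum.ext (by
            rw [HeightOneSpectrum.under_asIdeal]; exact hw'v)
          have := huniq w' hw'
          rw [this, hfw, h2] at hf1
          exact absurd hf1 (by norm_num)
        have hst' := hst α hα
        rw [if_neg hnosplit] at hst'
        rw [hε2 Φ hΦH]
        -- `charpoly (-M) = ∏ (X - f(-a)) = ∏ (X - f a)`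
        rw [Summit.Langlands.Langlands.Theorems.EssSelfDualIrreducibleCM.arithFrobPolyOfSatake_eq_prod]
          at hch ⊢
        rw [Summit.Langlands.Langlands.Theorems.IrreducibleGL3CM.charpoly_units_smul_of_charpoly_eq_prod
          (-1 : (PadicAlgCl ℓ)ˣ) hch, Multiset.map_map]
        conv_rhs => rw [← hst', Multiset.map_map, Multiset.map_map]
        refine congrArg Multiset.prod (Multiset.map_congr rfl fun a _ => ?_)
        simp only [Function.comp_apply, Units.val_neg, Units.val_one, neg_one_mul, mul_neg, inv_neg,
          map_neg]
  exact FramedGaloisRep.nonempty_equiv_of_hasFrobCharpolyAt_eventually chebotarev_artinRep_holds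
    _ _ hss' hss h

/-- **The stub `stub_cliffordDichotomy` (registered signature, verbatim).** See
`exists_eigenbasis_or_doubled_of_twist_equiv` for the algebra and
`nonempty_equiv_twist_of_isQuadSelfTwisted` for the self-twist. [folklore] -/
theorem stub_cliffordDichotomy :
    ∀ (K : Type) [Field K] [NumberField K] (hcpt : isCompact_glFiniteIntegralLevel 4 K)
      (π : CuspidalAutomorphicRepData 4 K hcpt) (L : Type) [Field L] [NumberField L] [Algebra K L],
      IsQuadSelfTwisted π L → ∀ (ℓ : ℕ) [Fact ℓ.Prime] (ι : PadicAlgCl ℓ ≃+* ℂ)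
        (ρ : FramedGaloisRep K (PadicAlgCl ℓ) 4), ρ.toGaloisRep.IsSemisimple → IsCompatibleWith π ι ρ →
          ¬ ρ.toGaloisRep.IsIrreducible →
            IsSumOfFourCharacters (ρ.restrictField L) ∨ IsDoubled (ρ.restrictField L) := by
  intro K _ _ hcpt π L _ _ _ hq ℓ _ ι ρ hss hcomp hirr
  classical
  have h2 := hq.1
  haveI : FiniteDimensional K L := Module.finite_of_finrank_pos (by rw [h2]; exact two_pos)
  obtain ⟨hopen, hH2⟩ := isOpen_range_absGaloisRestrict_and_index_eq_two K L h2
  set H : Subgroup (absoluteGaloisGroup K) := (absGaloisRestrict K L).range with hHdef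
  haveI : Algebra.IsSeparable K L := Algebra.IsSeparable.of_integral K L
  haveI : IsGalois K L := Literature.FieldTheory.Galois.isGalois_of_finrank_eq_two (F := K) h2
  haveI hHn : H.Normal := normal_range_absGaloisRestrict K L
  -- the quadratic character `ε`
  set ε₀ : absoluteGaloisGroup K →* (PadicAlgCl ℓ)ˣ := signCharOfIndexTwo (R := PadicAlgCl ℓ) H hH2
  have hker : IsOpen (ε₀.ker : Set (absoluteGaloisGroup K)) := by
    rw [ker_signCharOfIndexTwo]; exact hopen
  let ε : absoluteGaloisGroup K →ₜ* (PadicAlgCl ℓ)ˣ := ⟨ε₀, MonoidHom.continuous_of_isOpen_ker _ hker⟩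
  have hε1 : ∀ g ∈ H, ε g = 1 := fun g hg => signCharOfIndexTwo_apply_of_mem hH2 hg
  have hε2 : ∀ g ∉ H, ε g = -1 := fun g hg => signCharOfIndexTwo_apply_of_not_mem hH2 hg
  -- an element off `H`
  obtain ⟨g₀, hg₀⟩ : ∃ g : absoluteGaloisGroup K, g ∉ H := by
    by_contra! hall
    have htop : H = ⊤ := eq_top_iff.mpr fun x _ => hall x
    rw [htop, Subgroup.index_top] at hH2
    exact absurd hH2 (by norm_num)
  have hmul : ∀ a b : absoluteGaloisGroup K, a ∉ H → b ∉ H → a⁻¹ * b ∈ H := fun a b ha hb =>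
    (Subgroup.mul_mem_iff_of_index_two hH2).mpr (iff_of_false (fun h => ha (H.inv_mem_iff.mp h)) hb)
  have hεg₀ : ε.toMonoidHom g₀ ≠ 1 := by
    change ε g₀ ≠ 1
    rw [hε2 g₀ hg₀]; exact neg_one_ne_one_units
  have hεH : ∀ g ∈ H, ε.toMonoidHom g = 1 := hε1
  -- the intertwiner `T : ρ ⊗ ε ≃ ρ`
  obtain ⟨e⟩ := nonempty_equiv_twist_of_isQuadSelfTwisted K π L hq ι ρ hss hcomp ε hε1 hε2
  set ρV : Representation (PadicAlgCl ℓ) (absoluteGaloisGroup K) (Fin 4 → PadicAlgCl ℓ) :=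
    FramedRep.toRepresentation ρ with hρVdef
  have htwV : FramedRep.toRepresentation (FramedRep.twist ρ ε) =
      Literature.RepresentationTheory.Semisimple.Representation.twist ρV ε.toMonoidHom :=
    Summit.Langlands.Langlands.Theorems.EssSelfDualIrreducibleCM.toRepresentation_twist ρ ε
  let T : (Literature.RepresentationTheory.Semisimple.Representation.twist ρV ε.toMonoidHom).Equiv ρV :=
    Representation.Equiv.mk e.toRepEquiv.toLinearEquiv fun g => LinearMap.ext fun v => by
      have hint := Representation.IntertwiningMap.isIntertwining _ _ e.toRepEquiv.toIntertwiningMap g v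
      rw [Representation.Equiv.coe_toIntertwiningMap] at hint
      change e.toRepEquiv.toLinearEquiv ((Literature.RepresentationTheory.Semisimple.Representation.twist
        ρV ε.toMonoidHom) g v) = ρV g (e.toRepEquiv.toLinearEquiv v)
      rw [← htwV]
      exact hint
  haveI : ρV.IsSemisimpleRepresentation := hss
  have hV : Module.finrank (PadicAlgCl ℓ) (Fin 4 → PadicAlgCl ℓ) = 4 := Module.finrank_fin_fun _
  have hirrV : ¬ ρV.IsIrreducible := hirr
  -- the restriction to `Γ_L`
  set r : FramedGaloisRep L (PadicAlgCl ℓ) 4 := ρ.restrictField L with hrdef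
  have hr : ∀ σ : absoluteGaloisGroup L, r σ = ρ (absGaloisRestrict K L σ) := fun σ => rfl
  have hrV : ∀ (σ : absoluteGaloisGroup L) (x : Fin 4 → PadicAlgCl ℓ),
      r.toRepresentation σ x = ρV (absGaloisRestrict K L σ) x := fun σ x => rfl
  have hmemH : ∀ σ : absoluteGaloisGroup L, absGaloisRestrict K L σ ∈ H := fun σ => ⟨σ, rfl⟩
  rcases exists_eigenbasis_or_doubled_of_twist_equiv (H := H) (ε := ε.toMonoidHom) (ρ := ρV)
    hg₀ hmul hεH hεg₀ hV hirrV T with ⟨b, hb⟩ | ⟨U, U', hU, hU', hc, hU2, eU, heU⟩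
  · -- ### shape (A): four continuous characters
    left
    have hline : ∀ i : Fin 4, ∃ τ : FramedRep (absoluteGaloisGroup L) (PadicAlgCl ℓ) 1,
        ∀ σ : absoluteGaloisGroup L, r.toRepresentation σ (b i) =
          ((Matrix.GeneralLinearGroup.det (τ σ) : (PadicAlgCl ℓ)ˣ) : PadicAlgCl ℓ) • b i := by
      intro i
      refine FramedRep.exists_rankOne_of_stableLine r (b.ne_zero i) fun σ => ?_
      obtain ⟨c, hc⟩ := hb _ (hmemH σ) i
      exact ⟨c, by rw [hrV]; exact hc⟩
    choose τ hτ using hline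
    refine ⟨fun i => FramedRep.det (τ i), fun σ => ?_⟩
    -- the matrix of `r σ` in the basis `b` is diagonal
    have hcp : FramedRep.charpoly r σ = (r.toRepresentation σ).charpoly :=
      FramedRep.charpoly_eq_charpoly_toRepresentation r σ
    have hdiag : LinearMap.toMatrix b b (r.toRepresentation σ) =
        Matrix.diagonal fun i => ((Matrix.GeneralLinearGroup.det (τ i σ) : (PadicAlgCl ℓ)ˣ) :
          PadicAlgCl ℓ) := by
      ext i j
      rw [LinearMap.toMatrix_apply, hτ j σ, map_smul, b.repr_self, Matrix.diagonal_apply,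
        Finsupp.smul_apply, Finsupp.single_apply, smul_eq_mul]
      by_cases hij : i = j
      · subst hij; simp
      · rw [if_neg (Ne.symm hij), if_neg hij, mul_zero]
    change FramedRep.charpoly r σ = _
    rw [hcp, ← LinearMap.charpoly_toMatrix _ b, hdiag, Matrix.charpoly_diagonal]
    rfl
  · -- ### shape (B): the frame of `U`
    right
    haveI : IsModuleTopology (PadicAlgCl ℓ) U := TwistedSum.isModuleTopology_submodule_pi U
    set Uρ : Subrepresentation ρV := ⟨U, fun g _ hx => hU g _ hx⟩ with hUρ
    let σU : ContinuousRep (absoluteGaloisGroup L) (PadicAlgCl ℓ) U :=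
      ⟨Uρ.toRepresentation.comp (absGaloisRestrict K L).toMonoidHom, by
        rw [Topology.IsInducing.subtypeVal.continuous_iff]
        change Continuous fun q : absoluteGaloisGroup L × U =>
          ((r q.1 : GL (Fin 4) (PadicAlgCl ℓ)) : Matrix (Fin 4) (Fin 4) (PadicAlgCl ℓ)).mulVec
            (q.2 : Fin 4 → PadicAlgCl ℓ)
        exact ((Units.continuous_val.comp ((map_continuous r).comp continuous_fst)).matrix_mulVec
          (continuous_subtype_val.comp continuous_snd))⟩
    let bU : Module.Basis (Fin 2) (PadicAlgCl ℓ) U := Module.finBasisOfFinrankEq _ _ hU2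
    let W : FramedGaloisRep L (PadicAlgCl ℓ) 2 := σU.frame bU
    have hW : ∀ σ : absoluteGaloisGroup L, ((W σ : GL (Fin 2) (PadicAlgCl ℓ)) : Matrix _ _ _) =
        LinearMap.toMatrix bU bU ((ρV (absGaloisRestrict K L σ)).restrict (hU _)) := fun σ => rfl
    refine ⟨W, fun σ => ?_⟩
    set f := ρV (absGaloisRestrict K L σ) with hf
    have hcp : FramedRep.charpoly r σ = f.charpoly := FramedRep.charpoly_eq_charpoly_toRepresentation r σ
    -- `f|_{U'}` is conjugate to `f|_U` by the `H`-equivariant `eU`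
    have hconj : eU.conj (f.restrict (hU _)) = f.restrict (hU' _) := by
      apply LinearMap.ext
      intro u'
      obtain ⟨u, rfl⟩ := eU.surjective u'
      rw [LinearEquiv.conj_apply_apply, LinearEquiv.symm_apply_apply]
      apply Subtype.ext
      rw [LinearMap.coe_restrict_apply]
      exact heU _ (hmemH σ) u
    change FramedRep.charpoly r σ = _
    rw [hcp, LinearMap.charpoly_eq_mul_of_isCompl hc f (hU _) (hU' _), ← hconj, LinearEquiv.charpoly_conj,
      ← LinearMap.charpoly_toMatrix _ bU, ← hW, sq]

end Summit.Langlands.Langlands.Cruxes.SelfTwistedIrreducible.DetPinning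

end
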